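import Literature.RingTheory.FittingIdeal.Localization
import Literature.RingTheory.FittingIdeal.LocalRing
import Mathlib.RingTheory.Localization.Finiteness
import Mathlib.RingTheory.Localization.Ideal
import HarnessLib

/-!
# The support of the Fitting ideals: Stacks 07ZC at a prime, both directions

Topic: `Literature/RingTheory/FittingIdeal`. The Stacks Project, Tag 07ZC: "Let `R` be a ring.
Let `M` be a finite `R`-module. Let `k ≥ 0`. Let `𝔭 ⊂ R` be a prime ideal. The following are
equivalent (1) `Fit_k(M) ⊄ 𝔭`, … (3) `M_𝔭` can be generated by `k` elements over `R_𝔭`".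
`LocalRing.lean` proves (3) ⇒ (1) (`Module.exists_mem_fittingIdeal_notMem`) and (1) ⇒ (3) over
a LOCAL ring (`Module.exists_span_eq_top_of_fittingIdeal_eq_top`); with the localisation
theorem `Module.fittingIdeal_of_isLocalizedModule` (`Localization.lean`: `Fitt_k(M_𝔭) =
Fitt_k(M) R_𝔭`) the two combine into the printed equivalence at an arbitrary prime. PROVED:

* `Module.exists_span_eq_top_of_not_fittingIdeal_le` — (1) ⇒ (3): `Fitt_k(M) ⊄ 𝔭` implies
  `M_𝔭` is generated by `k` elements;
* `Module.fittingIdeal_le_iff_forall_span_ne_top` — (1) ⇔ (3): `Fitt_k(M) ⊆ 𝔭` iff no `k`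
  elements generate `M_𝔭`. Hence `V(Fitt_k(M)) = {𝔭 | M_𝔭 needs more than k generators}`; for
  `M = Ω_{X/S}` and `k = 1` (de Jong 1996, 2.21; Stacks 0C3K) the support of `Sing(f)` is the
  set of points where `Ω_{X/S,x}` is not cyclic.

## Sources

* The Stacks Project, Tag 07ZC; Tag 0C3K. [StacksProject]
* D. Eisenbud, *Commutative Algebra with a View Toward Algebraic Geometry*, GTM 150 (1995),
  Prop. 20.6. [Eisenbud1995]
-/

namespace Literature.RingTheory.FittingIdeal

universe u v

variable {R : Type u} [CommRing R] {M : Type v} [AddCommGroup M] [Module R M]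

/-- **Stacks 07ZC, (1) ⇒ (3) at a prime**: for a finite `R`-module `M`, a prime `𝔭`, a
localisation `R' = R_𝔭` and a localised module `f : M → M'` at `𝔭`: if `Fitt_k(M) ⊄ 𝔭` then
`M'` is generated by `k` elements over `R'` — `Fitt_k(M') = Fitt_k(M) R' = R'`
(`Module.fittingIdeal_of_isLocalizedModule`) and 07ZC over the local ring `R'`
(`Module.exists_span_eq_top_of_fittingIdeal_eq_top`). [cite: StacksProject, Tag 07ZC] -/
theorem Module.exists_span_eq_top_of_not_fittingIdeal_le [Module.Finite R M] (P : Ideal R)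
    [P.IsPrime] (R' : Type*) [CommRing R'] [Algebra R R'] [IsLocalization.AtPrime R' P]
    {M' : Type*} [AddCommGroup M'] [Module R M'] [Module R' M'] [IsScalarTower R R' M']
    (f : M →ₗ[R] M') [IsLocalizedModule P.primeCompl f] {k : ℕ}
    (hk : ¬ Module.fittingIdeal R M k ≤ P) :
    ∃ y : Fin k → M', Submodule.span R' (Set.range y) = ⊤ := by
  haveI : IsLocalRing R' := IsLocalization.AtPrime.isLocalRing R' P
  haveI : Module.Finite R' M' := Module.Finite.of_isLocalizedModule P.primeCompl f
  refine Module.exists_span_eq_top_of_fittingIdeal_eq_top (R := R') (M := M') ?_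
  rw [Module.fittingIdeal_of_isLocalizedModule P.primeCompl R' f k]
  -- `Fitt_k(M) R' = R'` since `Fitt_k(M)` meets the complement of `𝔭`
  by_contra hne
  rw [← ne_eq, IsLocalization.map_algebraMap_ne_top_iff_disjoint P.primeCompl R'] at hne
  exact hk fun r hr => by
    by_contra hrP
    exact Set.disjoint_left.mp hne (show r ∈ (P.primeCompl : Set R) from hrP) hr

/-- **Stacks 07ZC, (1) ⇔ (3)**: for a finite `R`-module `M` and a prime `𝔭`,
`Fitt_k(M) ⊆ 𝔭` iff `M_𝔭` cannot be generated by `k` elements over `R_𝔭`. So the closed set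
`V(Fitt_k(M))` is the locus of primes where `M` needs more than `k` generators — for
`M = Ω_{X/S}`, `k = 1`: the support of de Jong 1996, 2.21's `Sing(f) = V(Fitt₁ Ω_{X/S})` is the
set of points at which `Ω_{X/S,x}` is not cyclic (Stacks 0C3K). [cite: StacksProject, Tag 07ZC] -/
theorem Module.fittingIdeal_le_iff_forall_span_ne_top [Module.Finite R M] (P : Ideal R)
    [P.IsPrime] (R' : Type*) [CommRing R'] [Algebra R R'] [IsLocalization.AtPrime R' P]
    {M' : Type*} [AddCommGroup M'] [Module R M'] [Module R' M'] [IsScalarTower R R' M']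
    (f : M →ₗ[R] M') [IsLocalizedModule P.primeCompl f] (k : ℕ) :
    Module.fittingIdeal R M k ≤ P ↔
      ∀ y : Fin k → M', Submodule.span R' (Set.range y) ≠ ⊤ := by
  constructor
  · intro hle y hy
    obtain ⟨d, hd, hdP⟩ := Module.exists_mem_fittingIdeal_notMem P R' f y hy
    exact hdP (hle hd)
  · intro h
    by_contra hk
    obtain ⟨y, hy⟩ := Module.exists_span_eq_top_of_not_fittingIdeal_le P R' f hk
    exact h y hy

end Literature.RingTheory.FittingIdeal
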